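import Mathlib

/-!
# Softmax with bounded logits: weight bounds and the uniform-proposal acceptance bound (DEQ-A108)

HONEST FRAMING: instance-level adjudication of specific advantage claims; no claim about
BQP vs BPP or the summit.

Context (cell pub-qadeq, claim A-108 = Guo–Yu–Choi–Han–Agrawal–Nakaji–Aspuru-Guzik–Rebentrost,
"Quantum Transformer", arXiv:2402.16714v3; adjudication `pub-qadeq-deq-1/DEQ-A108.md`, unit
pub-qadeq-deq-1 gen 18, request LEAN-A108 of DEQ-A108 §10, filed by the cell lead).  DEQ-A108 Lemma
A108-1(b): if every softmax logit satisfies `|ℓ_k| ≤ L` then every softmax weight lies in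
`[e^{-2L}/N, e^{2L}/N]` (so for `L = O(1/N)` the attention row is uniform pooling up to `e^{±2L}`);
Theorem A108-A(iii): the acceptance probability of rejection sampling from the UNIFORM proposal on
`[N]` with acceptance ratio `e^{ℓ_k - L}` — which returns exact softmax samples without the partition
function — equals `(∑_i e^{ℓ_i})/(N e^{L})` and is at least `e^{-2L}`.  Elementary real inequalities
(`Real.exp` monotone, `Finset.sum_le_sum`); no definition, no named fact, no `sorry`.
-/

namespace Summit.QuantumAdvantage.Dequantization.SoftmaxBoundedLogits

open Finset Real

variable {N : ℕ} (l : Fin N → ℝ) {L : ℝ}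

/-- Under `|ℓ_i| ≤ L` each term satisfies `e^{-L} ≤ e^{ℓ_i} ≤ e^{L}`. -/
theorem exp_logit_mem (hl : ∀ i, |l i| ≤ L) (i : Fin N) :
    exp (-L) ≤ exp (l i) ∧ exp (l i) ≤ exp L :=
  ⟨exp_le_exp.mpr (abs_le.mp (hl i)).1, exp_le_exp.mpr (abs_le.mp (hl i)).2⟩

/-- The partition function is squeezed: `N e^{-L} ≤ ∑_i e^{ℓ_i} ≤ N e^{L}`. -/
theorem partition_bounds (hl : ∀ i, |l i| ≤ L) :
    (N : ℝ) * exp (-L) ≤ ∑ i, exp (l i) ∧ ∑ i, exp (l i) ≤ (N : ℝ) * exp L := by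
  constructor
  · calc (N : ℝ) * exp (-L) = ∑ _i : Fin N, exp (-L) := by simp
      _ ≤ ∑ i, exp (l i) := sum_le_sum fun i _ => (exp_logit_mem l hl i).1
  · calc ∑ i, exp (l i) ≤ ∑ _i : Fin N, exp L := sum_le_sum fun i _ => (exp_logit_mem l hl i).2
      _ = (N : ℝ) * exp L := by simp

/-- **DEQ-A108 Lemma A108-1(b) (softmax weight bounds).** For `N ≥ 1` logits with `|ℓ_i| ≤ L`,
every softmax weight `p_k = e^{ℓ_k}/∑_i e^{ℓ_i}` satisfies `e^{-2L}/N ≤ p_k ≤ e^{2L}/N`. -/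
theorem softmax_weight_bounds (hN : 0 < N) (hl : ∀ i, |l i| ≤ L) (k : Fin N) :
    exp (-2 * L) / N ≤ exp (l k) / ∑ i, exp (l i) ∧
      exp (l k) / ∑ i, exp (l i) ≤ exp (2 * L) / N := by
  have hNpos : (0 : ℝ) < N := by exact_mod_cast hN
  obtain ⟨hZlo, hZhi⟩ := partition_bounds l hl
  obtain ⟨hklo, hkhi⟩ := exp_logit_mem l hl k
  have hZpos : 0 < ∑ i, exp (l i) := lt_of_lt_of_le (by positivity) hZlo
  constructor
  · -- e^{-2L}/N = e^{-L}/(N e^{L}) ≤ e^{ℓ_k}/Z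
    rw [div_le_div_iff₀ hNpos hZpos]
    calc exp (-2 * L) * ∑ i, exp (l i) ≤ exp (-2 * L) * ((N : ℝ) * exp L) :=
          mul_le_mul_of_nonneg_left hZhi (exp_pos _).le
      _ = exp (-L) * N := by
          rw [show (-2 : ℝ) * L = -L + -L by ring, Real.exp_add]
          have : exp (-L) * exp L = 1 := by rw [← Real.exp_add]; simp
          calc exp (-L) * exp (-L) * ((N : ℝ) * exp L)
              = exp (-L) * N * (exp (-L) * exp L) := by ring
            _ = exp (-L) * N := by rw [this, mul_one]
      _ ≤ exp (l k) * N := mul_le_mul_of_nonneg_right hklo hNpos.le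
  · rw [div_le_div_iff₀ hZpos hNpos]
    calc exp (l k) * (N : ℝ) ≤ exp L * N := mul_le_mul_of_nonneg_right hkhi hNpos.le
      _ = exp (2 * L) * ((N : ℝ) * exp (-L)) := by
          rw [show (2 : ℝ) * L = L + L by ring, Real.exp_add]
          have : exp L * exp (-L) = 1 := by rw [← Real.exp_add]; simp
          calc exp L * (N : ℝ) = exp L * N * (exp L * exp (-L)) := by rw [this, mul_one]
            _ = exp L * exp L * ((N : ℝ) * exp (-L)) := by ring
      _ ≤ exp (2 * L) * ∑ i, exp (l i) := mul_le_mul_of_nonneg_left hZlo (exp_pos _).le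

/-- **DEQ-A108 Theorem A108-A(iii) (acceptance of the uniform-proposal rejection sampler).**
Proposing `k` uniformly on `[N]` and accepting with probability `e^{ℓ_k - L} ≤ 1` accepts with overall
probability `(∑_i e^{ℓ_i})/(N e^{L}) ≥ e^{-2L}` when `|ℓ_i| ≤ L`; the accepted index is exactly
softmax-distributed and the partition function is never computed. -/
theorem accept_prob_lower (hN : 0 < N) (hl : ∀ i, |l i| ≤ L) :
    exp (-2 * L) ≤ (∑ i, exp (l i)) / ((N : ℝ) * exp L) := by
  have hNpos : (0 : ℝ) < N := by exact_mod_cast hN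
  have hden : 0 < (N : ℝ) * exp L := mul_pos hNpos (exp_pos _)
  rw [le_div_iff₀ hden]
  obtain ⟨hZlo, _⟩ := partition_bounds l hl
  calc exp (-2 * L) * ((N : ℝ) * exp L) = (N : ℝ) * exp (-L) := by
        rw [show (-2 : ℝ) * L = -L + -L by ring, Real.exp_add]
        have : exp (-L) * exp L = 1 := by rw [← Real.exp_add]; simp
        calc exp (-L) * exp (-L) * ((N : ℝ) * exp L) = (N : ℝ) * exp (-L) * (exp (-L) * exp L) := by ring
          _ = (N : ℝ) * exp (-L) := by rw [this, mul_one]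
    _ ≤ ∑ i, exp (l i) := hZlo

/-- The acceptance ratio used by the sampler is a probability: `e^{ℓ_k - L} ≤ 1` under `|ℓ_k| ≤ L`
(and it is positive). -/
theorem accept_ratio_mem_unit (hl : ∀ i, |l i| ≤ L) (k : Fin N) :
    0 < exp (l k - L) ∧ exp (l k - L) ≤ 1 :=
  ⟨exp_pos _, by rw [← Real.exp_zero]; exact exp_le_exp.mpr (by linarith [(abs_le.mp (hl k)).2])⟩

/-- Ratio form of the weight bounds: any two softmax weights differ by a factor at most `e^{2L}`,
`e^{ℓ_j} ≤ e^{2L} e^{ℓ_k}` — the "uniform pooling up to `e^{±2L}`" statement of Lemma A108-1. -/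
theorem exp_logit_ratio_le (hl : ∀ i, |l i| ≤ L) (j k : Fin N) :
    exp (l j) ≤ exp (2 * L) * exp (l k) := by
  rw [← Real.exp_add]
  exact exp_le_exp.mpr (by
    have hj := (abs_le.mp (hl j)).2
    have hk := (abs_le.mp (hl k)).1
    linarith)

end Summit.QuantumAdvantage.Dequantization.SoftmaxBoundedLogits
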